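import Summits.HodgeConjecture.HodgeConjecture.Theorems.K2E3OrbitClosureSemisimpleTransport
import Mathlib.LinearAlgebra.FiniteDimensional.Lemmas
import Mathlib.LinearAlgebra.Projection
import Mathlib.LinearAlgebra.Basis.Prod
import HarnessLib

/-!
# K2 ∕ E3 «EllipticInputs», unit U12 — helper file for socket #10 `sig_K2E3OrbitClosureContainsSemisimple`:
# minimal invariant subspaces and FLAG BASES (block upper-triangular form with semisimple level-diagonal part)

Cell `hodgecm-mathlib` (Track B «K2-LIT»), item h413 = `stmt-HodgeConjecture-24833`; author K2E3-p10 (g0).  PROOF lane (theorems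
only, no `sorry`); pure linear algebra over Mathlib.  Input of the `GL_N` model (`K2E3OrbitClosureFlagLimit`) and pattern of the hermitian
model (`K2E3OrbitClosureHermitianGradedBasis`) of [HarishChandra1999, §21 p. 87] «the closure of a `G`-orbit contains a semisimple element».

Strategy (elementary; no Jordan decomposition, no Borel–Tits): for an injective `g ∈ End(V)` choose a MINIMAL non-zero `g`-stable subspace
`W` (`exists_minimal_invtSubmodule`; `g|_W` is then semisimple, `isSemisimple_restrict_of_minimal`), a complement `C`, and recurse on the
compression of `g` to `C`; this yields a basis `b` with integer LEVELS `e` such that `g` is block upper-triangular for the level filtration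
with injective semisimple level-diagonal part `s` (`exists_flag_basis`); `isSemisimple_prodMap` assembles the diagonal blocks.

References: [HarishChandra1999] Harish-Chandra (notes by DeBacker–Sally), *Admissible invariant distributions on reductive p-adic groups*,
AMS ULS 16 (1999), §21 p. 87; the flag argument is folklore.
-/

set_option autoImplicit false
set_option linter.dupNamespace false

namespace Summit.HodgeConjecture.HodgeConjecture.Cruxes.H413.K2E3OrbitClosureFlagBasis

open Module Module.End

/-! ## §1 Minimal invariant subspaces -/

section Minimal

variable {K V : Type*} [Field K] [AddCommGroup V] [Module K V] [FiniteDimensional K V]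

/-- A non-zero finite-dimensional space carries a MINIMAL non-zero `g`-invariant subspace (one of least dimension). [folklore] -/
theorem exists_minimal_invtSubmodule (g : End K V) [Nontrivial V] :
    ∃ W ∈ g.invtSubmodule, W ≠ ⊥ ∧ ∀ W' ∈ g.invtSubmodule, W' ≤ W → W' = ⊥ ∨ W' = W := by
  classical
  have hex : ∃ m : ℕ, ∃ p : Submodule K V, p ∈ g.invtSubmodule ∧ p ≠ ⊥ ∧ finrank K p = m :=
    ⟨_, ⊤, Module.End.invtSubmodule.top_mem g, top_ne_bot, rfl⟩
  obtain ⟨W, hW, hWne, hWm⟩ := Nat.find_spec hex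
  refine ⟨W, hW, hWne, fun W' hW' hle => ?_⟩
  by_cases hW'ne : W' = ⊥
  · exact Or.inl hW'ne
  · refine Or.inr (Submodule.eq_of_le_of_finrank_eq hle (le_antisymm (Submodule.finrank_mono hle) ?_))
    rw [hWm]
    exact Nat.find_min' hex ⟨W', hW', hW'ne, rfl⟩

omit [FiniteDimensional K V] in
/-- The restriction of `g` to a minimal non-zero invariant subspace is semisimple (its only invariant subspaces are `⊥` and
itself). [folklore] -/
theorem isSemisimple_restrict_of_minimal (g : End K V) {W : Submodule K V} (hW : W ∈ g.invtSubmodule)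
    (hmin : ∀ W' ∈ g.invtSubmodule, W' ≤ W → W' = ⊥ ∨ W' = W) :
    Module.End.IsSemisimple (g.restrict hW) := by
  rw [Module.End.isSemisimple_restrict_iff]
  intro q hq hle
  rcases hmin q hq hle with rfl | rfl
  · exact ⟨W, le_rfl, hW, disjoint_bot_left, bot_sup_eq _⟩
  · exact ⟨⊥, bot_le, Module.End.invtSubmodule.bot_mem g, disjoint_bot_right, sup_bot_eq _⟩

/-- An injective endomorphism maps each invariant subspace ONTO itself (finite dimension). [folklore] -/
theorem map_eq_of_mem_invtSubmodule {g : End K V} (hg : Function.Injective g) {W : Submodule K V}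
    (hW : W ∈ g.invtSubmodule) : W.map g = W :=
  Submodule.eq_of_le_of_finrank_eq ((Module.End.mem_invtSubmodule_iff_map_le g).1 hW)
    (LinearEquiv.finrank_eq (Submodule.equivMapOfInjective g hg W)).symm

end Minimal

/-! ## §2 Direct sums of semisimple endomorphisms -/

section ProdMap

variable {R M M₂ : Type*} [CommRing R] [AddCommGroup M] [Module R M] [AddCommGroup M₂] [Module R M₂]

/-- `f × g` is semisimple when `f` and `g` are. [folklore] -/
theorem isSemisimple_prodMap {f : End R M} {g : End R M₂} (hf : f.IsSemisimple) (hg : g.IsSemisimple) :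
    Module.End.IsSemisimple (f.prodMap g) := by
  let N : Bool → Submodule R (M × M₂) := fun c =>
    cond c (LinearMap.range (LinearMap.inl R M M₂)) (LinearMap.range (LinearMap.inr R M M₂))
  have hN : ∀ c, N c ∈ Module.End.invtSubmodule (f.prodMap g) := by
    intro c
    rw [Module.End.mem_invtSubmodule_iff_forall_mem_of_mem]
    cases c
    · rintro _ ⟨y, rfl⟩; exact ⟨g y, by simp⟩
    · rintro _ ⟨x, rfl⟩; exact ⟨f x, by simp⟩
  have htop : ⨆ c, N c = ⊤ := by
    rw [iSup_bool_eq]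
    exact LinearMap.sup_range_inl_inr
  refine K2E3OrbitClosureSemisimpleTransport.isSemisimple_of_iSup_eq_top _ N hN htop fun c => ?_
  cases c
  · -- `inr`: the restriction is `g`
    let l : M₂ →ₗ[R] N false :=
      { toFun := fun y => ⟨(0, y), y, rfl⟩
        map_add' := fun _ _ => Subtype.ext (by simp)
        map_smul' := fun _ _ => Subtype.ext (by simp) }
    have hl : Function.Bijective l := by
      refine ⟨fun x y hxy => ?_, ?_⟩
      · have := congrArg (fun z : N false => (z : M × M₂).2) hxy
        simpa [l] using this
      · rintro ⟨_, y, rfl⟩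
        exact ⟨y, rfl⟩
    refine (K2E3OrbitClosureSemisimpleTransport.isSemisimple_iff_of_semilinear l hl (f := g)
      (g := (f.prodMap g).restrict (hN false)) fun y => ?_).1 hg
    apply Subtype.ext
    simp [l]
  · let l : M →ₗ[R] N true :=
      { toFun := fun x => ⟨(x, 0), x, rfl⟩
        map_add' := fun _ _ => Subtype.ext (by simp)
        map_smul' := fun _ _ => Subtype.ext (by simp) }
    have hl : Function.Bijective l := by
      refine ⟨fun x y hxy => ?_, ?_⟩
      · have := congrArg (fun z : N true => (z : M × M₂).1) hxy
        simpa [l] using this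
      · rintro ⟨_, x, rfl⟩
        exact ⟨x, rfl⟩
    refine (K2E3OrbitClosureSemisimpleTransport.isSemisimple_iff_of_semilinear l hl (f := f)
      (g := (f.prodMap g).restrict (hN true)) fun y => ?_).1 hf
    apply Subtype.ext
    simp [l]

end ProdMap

/-! ## §3 Flag bases -/

section Flag

variable {K : Type*} [Field K]

/-- **Flag bases.**  For an injective endomorphism `g` of a finite-dimensional space there are a basis `b`, integer LEVELS `e` on the
basis and an injective SEMISIMPLE endomorphism `s` such that `g` is block upper-triangular for the level filtration
(`(g b_l)_k = 0` when `e_k < e_l`) and `s` is its level-diagonal part (`(s b_l)_k = (g b_l)_k` if `e_k = e_l`, else `0`).  Induction on the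
dimension: split off a minimal invariant subspace (top level) and recurse on the compression to a complement. [folklore] -/
theorem exists_flag_basis_aux (n : ℕ) :
    ∀ (V : Type*) [AddCommGroup V] [Module K V] [FiniteDimensional K V], finrank K V = n →
      ∀ g : Module.End K V, Function.Injective g →
        ∃ (ι : Type) (_ : Fintype ι) (b : Basis ι K V) (e : ι → ℤ) (s : Module.End K V),
          (∀ k l, e k < e l → b.repr (g (b l)) k = 0) ∧
          (∀ k l, b.repr (s (b l)) k = if e k = e l then b.repr (g (b l)) k else 0) ∧
          s.IsSemisimple ∧ Function.Injective s := by
  induction n using Nat.strong_induction_on with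
  | _ n ih =>
  intro V _ _ _ hn g hg
  classical
  rcases subsingleton_or_nontrivial V with hV | hV
  · refine ⟨PEmpty, inferInstance, Basis.empty V, fun _ => 0, 0, fun k => k.elim, fun k => k.elim,
      Module.End.isSemisimple_zero, fun x y _ => Subsingleton.elim x y⟩
  obtain ⟨W, hW, hWne, hWmin⟩ := exists_minimal_invtSubmodule g
  obtain ⟨C, hWC⟩ := W.exists_isCompl
  set prC : V →ₗ[K] C := C.projectionOnto W hWC.symm with hprC
  set prW : V →ₗ[K] W := W.projectionOnto C hWC with hprW
  let gC : Module.End K C := prC ∘ₗ g ∘ₗ C.subtype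
  have hgCdef : ∀ c : C, gC c = prC (g c) := fun _ => rfl
  have hgW : W.map g = W := map_eq_of_mem_invtSubmodule hg hW
  have hgC : Function.Injective gC := by
    intro x y hxy
    have h0 : prC (g ((x - y : C) : V)) = 0 := by
      rw [Submodule.coe_sub, map_sub, map_sub]
      exact sub_eq_zero.2 hxy
    rw [Submodule.projectionOnto_apply_eq_zero_iff, ← hgW] at h0
    obtain ⟨w, hw, hw'⟩ := h0
    have hwxy : w = ((x - y : C) : V) := hg hw'
    have hmem : ((x - y : C) : V) ∈ W ⊓ C := ⟨hwxy ▸ hw, (x - y).2⟩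
    rw [hWC.inf_eq_bot, Submodule.mem_bot, Submodule.coe_eq_zero, sub_eq_zero] at hmem
    exact hmem
  have hCdim : finrank K C < n := by
    have h1 := Submodule.finrank_add_eq_of_isCompl hWC
    have h2 : finrank K W ≠ 0 := fun h => hWne (Submodule.finrank_eq_zero.1 h)
    omega
  obtain ⟨ιC, _instC, bC, eC, sC, hC1, hC2, hC3, hC4⟩ := ih _ hCdim C rfl gC hgC
  -- the new top level
  set M : ℤ := (∑ l, |eC l|) + 1 with hMdef
  have hM : ∀ l, eC l < M := fun l => by
    have h1 : |eC l| ≤ ∑ i, |eC i| := Finset.single_le_sum (fun i _ => abs_nonneg (eC i)) (Finset.mem_univ l)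
    have h2 := le_abs_self (eC l)
    omega
  let bW := Module.finBasis K W
  set E : (W × C) ≃ₗ[K] V := W.prodEquivOfIsCompl C hWC with hEdef
  let b : Basis (Fin (finrank K W) ⊕ ιC) K V := (bW.prod bC).map E
  let e : Fin (finrank K W) ⊕ ιC → ℤ := Sum.elim (fun _ => M) eC
  let a : Module.End K W := g.restrict hW
  let s : Module.End K V := E.toLinearMap ∘ₗ (a.prodMap sC) ∘ₗ E.symm.toLinearMap
  have hEsymm : ∀ v, E.symm v = (prW v, prC v) := fun v => Submodule.prodEquivOfIsCompl_symm_apply hWC v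
  have hrepr_inl : ∀ v i, b.repr v (Sum.inl i) = bW.repr (prW v) i := by
    intro v i
    simp only [b, Basis.map_repr, LinearEquiv.trans_apply, hEsymm, Basis.prod_repr_inl]
  have hrepr_inr : ∀ v j, b.repr v (Sum.inr j) = bC.repr (prC v) j := by
    intro v j
    simp only [b, Basis.map_repr, LinearEquiv.trans_apply, hEsymm, Basis.prod_repr_inr]
  have hb_inl : ∀ i, b (Sum.inl i) = (bW i : V) := by
    intro i; simp [b, hEdef]
  have hb_inr : ∀ j, b (Sum.inr j) = (bC j : V) := by
    intro j; simp [b, hEdef]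
  have hprW_W : ∀ w : W, prW w = w := fun w => Submodule.projectionOnto_apply_left hWC w
  have hprC_W : ∀ w : W, prC w = 0 := fun w => Submodule.projectionOnto_apply_right hWC.symm w
  have hprW_C : ∀ c : C, prW c = 0 := fun c => Submodule.projectionOnto_apply_right hWC c
  have hprC_C : ∀ c : C, prC c = c := fun c => Submodule.projectionOnto_apply_left hWC.symm c
  have hgWmem : ∀ i, g (bW i : V) ∈ W := fun i => hW (bW i).2
  have hprC_gW : ∀ i, prC (g (bW i : V)) = 0 := fun i =>
    (Submodule.projectionOnto_apply_eq_zero_iff hWC.symm).2 (hgWmem i)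
  have hEapply : ∀ x : W × C, E x = (x.1 : V) + (x.2 : V) := fun x => rfl
  have hs_inl : ∀ i, s (b (Sum.inl i)) = g (bW i : V) := by
    intro i
    rw [hb_inl]
    simp only [s, LinearMap.comp_apply, LinearEquiv.coe_toLinearMap, hEsymm, hprW_W, hprC_W, LinearMap.prodMap_apply,
      map_zero, hEapply, Submodule.coe_zero, add_zero]
    rfl
  have hs_inr : ∀ j, s (b (Sum.inr j)) = (sC (bC j) : V) := by
    intro j
    rw [hb_inr]
    simp only [s, LinearMap.comp_apply, LinearEquiv.coe_toLinearMap, hEsymm, hprW_C, hprC_C, LinearMap.prodMap_apply,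
      map_zero, hEapply, Submodule.coe_zero, zero_add]
  refine ⟨Fin (finrank K W) ⊕ ιC, inferInstance, b, e, s, ?_, ?_, ?_, ?_⟩
  · rintro (i | j) (i' | j') hlt
    · simp [e] at hlt
    · exact absurd hlt (not_lt.2 (hM j').le)
    · rw [hb_inl, hrepr_inr, hprC_gW, map_zero, Finsupp.zero_apply]
    · rw [hb_inr, hrepr_inr, ← hgCdef]
      exact hC1 j j' (by simpa [e] using hlt)
  · rintro (i | j) (i' | j')
    · have he : e (Sum.inl i) = e (Sum.inl i') := rfl
      rw [if_pos he, hs_inl, hb_inl]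
    · rw [hs_inr, hrepr_inl, hprW_C, map_zero, Finsupp.zero_apply, if_neg]
      simpa [e] using (hM j').ne'
    · have he : ¬ e (Sum.inr j) = e (Sum.inl i') := by simpa [e] using (hM j).ne
      rw [if_neg he, hs_inl, hrepr_inr, hprC_gW, map_zero, Finsupp.zero_apply]
    · rw [hs_inr, hb_inr, hrepr_inr, hrepr_inr, hprC_C, hC2 j j', ← hgCdef]
      simp [e]
  · refine (LinearEquiv.isSemisimple_iff (a.prodMap sC) s E ?_).1
      (isSemisimple_prodMap (isSemisimple_restrict_of_minimal g hW hWmin) hC3)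
    apply LinearMap.ext
    intro x
    simp [s]
  · have ha : Function.Injective a := fun x y h => Subtype.ext (hg (by
      simpa [a, LinearMap.restrict_apply] using congrArg Subtype.val h))
    have hpm : Function.Injective (a.prodMap sC) := fun x y h =>
      Prod.ext (ha (congrArg Prod.fst h)) (hC4 (congrArg Prod.snd h))
    exact E.injective.comp (hpm.comp E.symm.injective)

/-- **Flag bases** (packaged): see `exists_flag_basis_aux`. [folklore] -/
theorem exists_flag_basis {V : Type*} [AddCommGroup V] [Module K V] [FiniteDimensional K V] (g : Module.End K V)
    (hg : Function.Injective g) :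
    ∃ (ι : Type) (_ : Fintype ι) (b : Basis ι K V) (e : ι → ℤ) (s : Module.End K V),
      (∀ k l, e k < e l → b.repr (g (b l)) k = 0) ∧
      (∀ k l, b.repr (s (b l)) k = if e k = e l then b.repr (g (b l)) k else 0) ∧
      s.IsSemisimple ∧ Function.Injective s :=
  exists_flag_basis_aux (finrank K V) V rfl g hg

end Flag

end Summit.HodgeConjecture.HodgeConjecture.Cruxes.H413.K2E3OrbitClosureFlagBasis
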